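import Summits.BirchSwinnertonDyer.BirchSwinnertonDyer.Theorems.ByReductionTypeAtTwoSupersingularFlatBlindTwistSideKummerLine
import Literature.NumberTheory.EllipticCurves.ZpExtensionGaloisTwistSharpFlatSelmerStructure
import Literature.NumberTheory.EllipticCurves.Rank1Residual.Predicates
import Literature.NumberTheory.EllipticCurves.DiscreteH1Equiv
import Literature.NumberTheory.EllipticCurves.SubgroupSelmerProofs
import Literature.NumberTheory.EllipticCurves.IwasawaSelmerControlLocalizationProofs
import Literature.NumberTheory.EllipticCurves.PeriodIndexCorestrictionLocal
import HarnessLib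

/-!
# The twist dictionary at `p = 2`, III (EXACT FORM): the intertwiner `ψ_J : E[2^J](χ₋₁) ≅ W₂[2^J]`
# transports the exact local conditions «dies over the local cyclotomic tower» OFF the distinguished
# place onto the `W₂`-side conditions — hand HT-C5 = h7 = binder B1 of the CDC_H glue of crux
# `SupersingularRankZeroAtTwo` (item stmt-BirchSwinnertonDyer-19097), line `odd_blind_package`, slot 5

Cell `bsd-2adic` (run/shared/lean/pub/bsd-2adic/), seat `bsd-2adic-tower-1` GEN 61, `--supports
stmt-BirchSwinnertonDyer-19097` (helper). HONEST FRAMING: THEOREMS ONLY (no `def`, no named fact, no instance,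
no `sorry`); nothing is booked; it closes no stub and no item: it is the binder `hB1` of LEAD ss-1 GEN 21's glue
`OddBlindLocal.flatBlindControlCardHondaAtTwo_of` (`…FlatBlindCardGlue.lean`), fed there by `exact`;
`SupersingularRankZeroAtTwo`, CDC_H and BSD are NOT proved by any of this. Continuation of
`…FlatBlindTwistSideDictionary.lean` (§1–§3) and `…FlatBlindTwistSideKummerLine.lean` (§4–§5).

## What

* §6 (generic, any `K`, `p`, `κ`, `u`, any `K`-field `E`). Along an intertwiner `φ : Y[p^J] → W[p^J](χ_u)` whose
  underlying map is an additive isomorphism `g : Y(K̄) ≃+ W(K̄)` with a local companion `g_E : Y(K̄_E) ≃+ W(K̄_E)`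
  (`pointsMap ∘ g = g_E ∘ pointsMap`) equivariant for the local tower subgroup `Λ_E = localSubgroup (ker κ) E`
  (`= Gal(K̄_E/(K_∞)_w)`), the square
  `twistedTorsionToLocalH1 ∘ H¹(φ|_E) = (g_E)_* ∘ res_{Λ_E} ∘ H¹(pointsMap)` commutes
  (`twistedTorsionToLocalH1_map_eq_h1Equiv_resH1Hom`; `(g_E)_*` = the tree's `h1Equiv`, an isomorphism). Hence,
  for an inverse intertwiner `ψ`, **`H¹(ψ|_E)` carries `ker twistedTorsionToLocalH1` («the twisted class dies in
  `H¹((K_∞)_w, W)`») ONTO `H¹(pointsMap)⁻¹ (ker res_{Λ_E})` («the class dies in `H¹((K_∞)_w, Y)`»)**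
  (`map_ker_twistedTorsionToLocalH1_eq_comap`); and where `Λ_E` is all of `Γ_E` (every archimedean place:
  `ZpExtension.resGal_infinitePlace_mem_kerSubgroup`) the latter IS the Kummer condition
  `Y.kummerLocalConditionAt (p^J) E = ker H¹(pointsMap)` (`comap_ker_resH1Hom_eq_kummerLocalConditionAt_of_forall_mem`,
  restriction to such a `Λ_E` being bijective: `bijective_resH1Hom_subgroupIncl`).
* §7 **`HTC5_dictionary`** — TYPE = the LEAD's hand h7 (`HOME/ss/gen21/HANDTARGETS_CDC3_GEN21.lean` :38–66 = hypothesis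
  `hB1` of `flatBlindControlCardHondaAtTwo_of`, `…FlatBlindCardGlue.lean` :75–102) VERBATIM: for `W/ℚ` (GoodSS at 2),
  `κ` cyclotomic, `v ∋ 2`, a local topological generator `g`, a model `W₂` of `W^{(2)}` and every `J`, mutually
  inverse intertwiners `φ/ψ : W₂[2^J] ⇄ E[2^J](χ₋₁)` (the twist isomorphism over `ℚ(√2) = ℚ_1`, as in
  `exists_intertwining_twist`) such that (ii) at every infinite place `H¹(ψ_w)` carries `ker twistedTorsionToLocalH1`
  onto `W₂.kummerLocalConditionAt (2^J) ℚ_w`; (iii) at every finite `v' ≠ v`, `H¹(ψ_{v'})` carries the ♭-family member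
  `twistedSharpFlatLocalFamily … v … v' = ker twistedTorsionToLocalH1` (`twistedSharpFlatLocalFamily_of_ne`) onto
  `H¹(torsionPointsMapIntertwining)⁻¹ (ker res_{Λ_{v'}})`; (iv) at `v`, `H¹(φ_v)` carries `W₂.kummerLocalConditionAt`
  into the twisted Kummer line of `E(ℚ_{1,v}) ∩ ker (g+1)` (the clause of `exists_intertwining_twist`, re-proved for
  this `φ`). The binders `GoodSS W 2`, `(2 : 𝓞 ℚ) ∈ v`, `c` and the minimality instances are idle here (they type
  the ♭-kernel `colemanKer … .flat`, which only enters at `v' = v`).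

References: [GreenbergLNM1716] §4 pp. 105–107, 122–124 (the modules `A_s`; «for archimedean `v` …
`𝒫_E^{(v)}(F) ≅ 𝒫_E^{(v)}(F_∞)^Γ`», p. 106–107), §3 p. 86 (archimedean places split completely in `F_∞/F`);
[SilvermanAEC2009] X.2 Prop. 2.4, X.5 Cor. 5.4, X.§4; [SerreGaloisCohomology1997] I §2.4 (compatible pairs);
[Sprung2012] Def. 7.11.
-/

set_option autoImplicit false
set_option linter.dupNamespace false

noncomputable section

open scoped Classical

universe u

namespace Summit.BirchSwinnertonDyer.BirchSwinnertonDyer.Theorems.FlatBlindTwistSide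

open Field NumberField IsDedekindDomain WeierstrassCurve CategoryTheory
open Literature.NumberTheory.EllipticCurves Literature.NumberTheory.GaloisRepresentations
  Literature.NumberTheory.EllipticCurves.ZpExtension Literature.NumberTheory.EllipticCurves.Kobayashi2003
open scoped ContRepresentation
open Summit.BirchSwinnertonDyer.BirchSwinnertonDyer.Theorems.OddBlindTwist (two_dvd_neg_one_sub_one)

/-! ## §6 Transport of the local tower-kernel condition along the twist (generic) -/

section TowerKernel

variable {K : Type u} [Field K] (W Y : WeierstrassCurve K) (p : ℕ) [Fact p.Prime]
  (κ : ZpExtension K p) (J : ℕ) (u : ℤ) (hu' : (p : ℤ) ∣ u - 1)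
  (E : Type u) [Field E] [Algebra K E]

/-- **The square `twistedTorsionToLocalH1 ∘ H¹(φ|_E) = (g_E)_* ∘ res_Λ ∘ H¹(pointsMap)`.** Let
`φ : Y[p^J] → W[p^J](χ_u)` be a `Γ_K`-intertwining map with underlying map an additive isomorphism
`g : Y(K̄) ≃+ W(K̄)`, and `g_E : Y(K̄_E) ≃+ W(K̄_E)` a local companion (`pointsMap ∘ g = g_E ∘ pointsMap`) that is
equivariant for the local tower subgroup `Λ = localSubgroup (ker κ) E`. Then for every `x ∈ H¹(Γ_E, Y[p^J])`,
`twistedTorsionToLocalH1 (H¹(φ|_E) x)` is the image under the isomorphism `(g_E)_* : H¹(Λ, Y(K̄_E)) ≃ H¹(Λ, W(K̄_E))`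
(`h1Equiv`) of the restriction to `Λ` of `H¹(pointsMap) x ∈ H¹(Γ_E, Y(K̄_E))` (both are the class of
`τ ↦ g_E (pointsMap (ξ τ))` on `Λ`). [cite: GreenbergLNM1716, §4 pp. 107, 124] [cite: SerreGaloisCohomology1997, I §2.4] -/
theorem twistedTorsionToLocalH1_map_eq_h1Equiv_resH1Hom
    (g : Y.geomPoints ≃+ W.geomPoints) (gE : localPoints Y E ≃+ localPoints W E)
    (hsq : ∀ P : Y.geomPoints, pointsMap W E (g P) = gE (pointsMap Y E P))
    (hgE : ∀ τ : absoluteGaloisGroup E, τ ∈ localSubgroup κ.kerSubgroup E →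
      ∀ Q : localPoints Y E, gE (τ • Q) = τ • gE Q)
    (φ : (Y.torsionGaloisModule ((p ^ J : ℕ) : ℤ)).toContRepresentation →ⁱL
      (W.twistedTorsionGaloisModule p κ J u hu').toContRepresentation)
    (hφ : ∀ T : Y.geomTorsion ((p ^ J : ℕ) : ℤ),
      ((φ T : W.geomTorsion ((p ^ J : ℕ) : ℤ)) : W.geomPoints) = g (T : Y.geomPoints))
    (x : galoisCohomology (GaloisRep.restrictField E (Y.torsionGaloisModule ((p ^ J : ℕ) : ℤ))) 1) :
    W.twistedTorsionToLocalH1 p κ J u hu' E (galoisCohomology.map (φ.restrictField E) 1 x) =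
      h1Equiv (G := localSubgroup κ.kerSubgroup E) gE (fun τ Q ↦ hgE τ τ.2 Q)
        (resH1Hom (Literature.NumberTheory.EllipticCurves.subgroupIncl (localSubgroup κ.kerSubgroup E))
          (AddMonoidHom.id (localPoints Y E)) (fun _ _ ↦ rfl)
          (galoisCohomology.map (Y.torsionPointsMapIntertwining ((p ^ J : ℕ) : ℤ) E) 1 x)) := by
  obtain ⟨ξ, rfl⟩ := oneCocycleClass_surjective _ x
  rw [galoisCohomology.map_one_oneCocycleClass, twistedTorsionToLocalH1_oneCocycleClass,
    map_torsionPointsMapIntertwining_oneCocycleClass, h1Equiv_apply,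
    Literature.NumberTheory.EllipticCurves.resH1Hom_oneCocycleClass,
    Literature.NumberTheory.EllipticCurves.resH1Hom_oneCocycleClass]
  refine congrArg (oneCocycleClass _) (Subtype.ext (ContinuousMap.ext fun τ ↦ ?_))
  rw [pullback_resHomOfEquivariant_apply, pullback_resHomOfEquivariant_apply]
  change pointsMap W E (((φ.restrictField E (ξ.1 (τ : absoluteGaloisGroup E)) :
      W.geomTorsion ((p ^ J : ℕ) : ℤ)) : W.geomPoints)) =
    gE (pointsMap Y E ((ξ.1 (τ : absoluteGaloisGroup E) : Y.geomTorsion ((p ^ J : ℕ) : ℤ)) : Y.geomPoints))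
  rw [ContIntertwiningMap.restrictField_apply, hφ, hsq]

/-- **`H¹(ψ|_E)` carries «the twisted class dies in `H¹((K_∞)_w, W)`» onto «the class dies in `H¹((K_∞)_w, Y)`».**
With `φ`, `g`, `g_E` as in `twistedTorsionToLocalH1_map_eq_h1Equiv_resH1Hom` and an inverse intertwiner `ψ`
(`ψφ = id`, `φψ = id`): the image under `H¹(ψ|_E)` of `ker (twistedTorsionToLocalH1 … E)` is the preimage under
`H¹(pointsMap) : H¹(Γ_E, Y[p^J]) → H¹(Γ_E, Y(K̄_E))` of the kernel of the restriction to the local tower subgroup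
`Λ = localSubgroup (ker κ) E` — `(g_E)_*` being injective. [cite: GreenbergLNM1716, §4 pp. 107, 124]
[cite: SerreGaloisCohomology1997, I §2.4] -/
theorem map_ker_twistedTorsionToLocalH1_eq_comap
    (g : Y.geomPoints ≃+ W.geomPoints) (gE : localPoints Y E ≃+ localPoints W E)
    (hsq : ∀ P : Y.geomPoints, pointsMap W E (g P) = gE (pointsMap Y E P))
    (hgE : ∀ τ : absoluteGaloisGroup E, τ ∈ localSubgroup κ.kerSubgroup E →
      ∀ Q : localPoints Y E, gE (τ • Q) = τ • gE Q)
    (φ : (Y.torsionGaloisModule ((p ^ J : ℕ) : ℤ)).toContRepresentation →ⁱL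
      (W.twistedTorsionGaloisModule p κ J u hu').toContRepresentation)
    (hφ : ∀ T : Y.geomTorsion ((p ^ J : ℕ) : ℤ),
      ((φ T : W.geomTorsion ((p ^ J : ℕ) : ℤ)) : W.geomPoints) = g (T : Y.geomPoints))
    (ψ : (W.twistedTorsionGaloisModule p κ J u hu').toContRepresentation →ⁱL
      (Y.torsionGaloisModule ((p ^ J : ℕ) : ℤ)).toContRepresentation)
    (hψφ : ∀ a, ψ (φ a) = a) (hφψ : ∀ b, φ (ψ b) = b) :
    ((W.twistedTorsionToLocalH1 p κ J u hu' E).ker).map (galoisCohomology.map (ψ.restrictField E) 1) =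
      ((resH1Hom (Literature.NumberTheory.EllipticCurves.subgroupIncl (localSubgroup κ.kerSubgroup E))
          (AddMonoidHom.id (localPoints Y E)) (fun _ _ ↦ rfl)).ker).comap
        (galoisCohomology.map (Y.torsionPointsMapIntertwining ((p ^ J : ℕ) : ℤ) E) 1) := by
  -- `H¹(ψ|_E)` and `H¹(φ|_E)` are mutually inverse
  have h1 : ∀ x, galoisCohomology.map (ψ.restrictField E) 1 (galoisCohomology.map (φ.restrictField E) 1 x) = x := by
    intro x
    obtain ⟨ξ, rfl⟩ := oneCocycleClass_surjective _ x
    rw [galoisCohomology.map_one_oneCocycleClass, galoisCohomology.map_one_oneCocycleClass]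
    exact congrArg (oneCocycleClass _) (Subtype.ext (ContinuousMap.ext fun σ ↦ hψφ (ξ.1 σ)))
  have h2 : ∀ y, galoisCohomology.map (φ.restrictField E) 1 (galoisCohomology.map (ψ.restrictField E) 1 y) = y := by
    intro y
    obtain ⟨ξ, rfl⟩ := oneCocycleClass_surjective _ y
    rw [galoisCohomology.map_one_oneCocycleClass, galoisCohomology.map_one_oneCocycleClass]
    exact congrArg (oneCocycleClass _) (Subtype.ext (ContinuousMap.ext fun σ ↦ hφψ (ξ.1 σ)))
  ext x
  constructor
  · rintro ⟨y, hy, rfl⟩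
    have hy' : W.twistedTorsionToLocalH1 p κ J u hu' E y = 0 := hy
    rw [← h2 y, twistedTorsionToLocalH1_map_eq_h1Equiv_resH1Hom W Y p κ J u hu' E g gE hsq hgE φ hφ,
      map_eq_zero_iff _ (h1Equiv _ _).injective] at hy'
    exact hy'
  · intro hx
    refine ⟨galoisCohomology.map (φ.restrictField E) 1 x, ?_, h1 x⟩
    change W.twistedTorsionToLocalH1 p κ J u hu' E (galoisCohomology.map (φ.restrictField E) 1 x) = 0
    rw [twistedTorsionToLocalH1_map_eq_h1Equiv_resH1Hom W Y p κ J u hu' E g gE hsq hgE φ hφ,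
      map_eq_zero_iff _ (h1Equiv _ _).injective]
    exact hx

/-- **Where the local tower subgroup is everything, «dies in `H¹((K_∞)_w, Y)`» is the Kummer condition.**
If every `τ ∈ Γ_E` lies in `Λ ≤ Γ_E` (e.g. `Λ = localSubgroup (ker κ) K_w` at an archimedean place `w`,
which splits completely in `K_∞/K`), the restriction `H¹(Γ_E, Y(K̄_E)) → H¹(Λ, Y(K̄_E))` is bijective
(`bijective_resH1Hom_subgroupIncl`), so `H¹(pointsMap)⁻¹ (ker res_Λ) = ker H¹(pointsMap) = Y.kummerLocalConditionAt n E`.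
[cite: GreenbergLNM1716, §3 p. 86 and §4 pp. 106–107] [cite: SilvermanAEC2009, X.§4] -/
theorem comap_ker_resH1Hom_eq_kummerLocalConditionAt_of_forall_mem (n : ℤ)
    (Λ : Subgroup (absoluteGaloisGroup E)) (hall : ∀ τ : absoluteGaloisGroup E, τ ∈ Λ) :
    ((resH1Hom (Literature.NumberTheory.EllipticCurves.subgroupIncl Λ) (AddMonoidHom.id (localPoints Y E))
        (fun _ _ ↦ rfl)).ker).comap (galoisCohomology.map (Y.torsionPointsMapIntertwining n E) 1) =
      Y.kummerLocalConditionAt n E := by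
  ext x
  change resH1Hom (Literature.NumberTheory.EllipticCurves.subgroupIncl Λ) (AddMonoidHom.id (localPoints Y E))
      (fun _ _ ↦ rfl) (galoisCohomology.map (Y.torsionPointsMapIntertwining n E) 1 x) = 0 ↔
    galoisCohomology.map (Y.torsionPointsMapIntertwining n E) 1 x = 0
  exact map_eq_zero_iff _ (bijective_resH1Hom_subgroupIncl (localPoints Y E) Λ hall).1

end TowerKernel

/-! ## §7 The hand HT-C5 = h7 = B1: the twist dictionary, exact form -/

section Hand

open scoped NumberField AddSubgroup
open Literature.NumberTheory.EllipticCurves.IwasawaDual Literature.NumberTheory.GaloisCohomology ZpExtension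
  Literature.NumberTheory.EllipticCurves.Sprung2017 Literature.NumberTheory.EllipticCurves.Sprung2012
  Literature.NumberTheory.EllipticCurves.Rank1Residual Summit.BirchSwinnertonDyer.Rank1Residual.Additive
open Literature.NumberTheory.GaloisRepresentations.DiscreteGaloisModule (SelmerStructure)

/-- **HT-C5 = h7 = B1 (THE TWIST DICTIONARY, EXACT FORM).** For `W/ℚ` (globally minimal, GoodSS at `2`), a
cyclotomic `ℤ₂`-extension `κ`, the place `v ∋ 2` with a local topological generator `g`, a globally minimal
model `W₂` of the quadratic twist `W^{(2)}` and every level `J`, there are mutually inverse `Γ_ℚ`-intertwiners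
`φ : W₂[2^J] ⇄ E[2^J](χ₋₁) : ψ` (the twist isomorphism over `ℚ_1 = ℚ(√2)`, sign `(−1)^{κ(σ) mod 2^J}`) such that:
(ii) at every infinite place `w`, `H¹(ψ_w)` carries `ker twistedTorsionToLocalH1` ONTO `W₂.kummerLocalConditionAt (2^J) ℚ_w`
(`w` splits completely in `ℚ_∞`, so both say «dies in `H¹(ℚ_w, ·)`», and the twist map is `Γ_{ℚ_w}`-equivariant);
(iii) at every finite `v' ≠ v`, `H¹(ψ_{v'})` carries the ♭-family member (`= ker twistedTorsionToLocalH1`, i.e.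
«dies in `H¹((ℚ_∞)_w, E)`») ONTO `H¹(torsionPointsMapIntertwining)⁻¹ (ker res_{Gal(ℚ̄_{v'}/(ℚ_∞)_w)})` («dies in
`H¹((ℚ_∞)_w, W₂)`»: the twist map is defined over `ℚ_{v'}(√2) ⊂ (ℚ_∞)_w`); (iv) at `v`, `H¹(φ_v)` carries
`W₂.kummerLocalConditionAt (2^J) ℚ_v` INTO the twisted Kummer line of `E(ℚ_{1,v}) ∩ ker (g + 1)`. TYPE = binder `hB1`
of `OddBlindLocal.flatBlindControlCardHondaAtTwo_of` (LEAD ss-1 GEN 21) verbatim; the binders `GoodSS W 2`,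
`(2 : 𝓞 ℚ) ∈ v`, `c` are idle. [cite: GreenbergLNM1716, §4 pp. 105–107, 124] [cite: SilvermanAEC2009, X.2 Prop. 2.4, X.5 Cor. 5.4, X.§4]
[cite: SerreGaloisCohomology1997, I §2.4] [cite: Sprung2012, Def. 7.11] -/
theorem HTC5_dictionary :
    ∀ (W : WeierstrassCurve ℚ) [W.IsElliptic] [W.IsGloballyMinimal], GoodSS W 2 →
      ∀ (κ : ZpExtension ℚ 2), κ.IsCyclotomic →
      ∀ (v : HeightOneSpectrum (𝓞 ℚ)), (2 : 𝓞 ℚ) ∈ v.asIdeal →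
      ∀ (g : Field.absoluteGaloisGroup (v.adicCompletion ℚ)) (c : ℕ → localPoints W (v.adicCompletion ℚ)),
        κ.IsTopGenerator (resGalOfEmb (closureEmb (K := ℚ) (v.adicCompletion ℚ)) g) →
      ∀ (W₂ : WeierstrassCurve ℚ) [W₂.IsElliptic] [W₂.IsGloballyMinimal],
        (∃ C : WeierstrassCurve.VariableChange ℚ, C • W.quadraticTwist 2 = W₂) →
      ∀ J : ℕ, ∃ (φ : (W₂.torsionGaloisModule ((2 ^ J : ℕ) : ℤ)).toContRepresentation →ⁱL
          (W.twistedTorsionGaloisModule 2 κ J (-1) OddBlindTwist.two_dvd_neg_one_sub_one).toContRepresentation)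
        (ψ : (W.twistedTorsionGaloisModule 2 κ J (-1) OddBlindTwist.two_dvd_neg_one_sub_one).toContRepresentation →ⁱL
          (W₂.torsionGaloisModule ((2 ^ J : ℕ) : ℤ)).toContRepresentation),
        (∀ a, ψ (φ a) = a) ∧ (∀ b, φ (ψ b) = b) ∧
        (∀ w : InfinitePlace ℚ, ((W.twistedTorsionToLocalH1 2 κ J (-1) OddBlindTwist.two_dvd_neg_one_sub_one w.Completion).ker).map
            (galoisCohomology.map (ψ.restrictField w.Completion) 1) =
          W₂.kummerLocalConditionAt ((2 ^ J : ℕ) : ℤ) w.Completion) ∧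
        (∀ v' : HeightOneSpectrum (𝓞 ℚ), v' ≠ v →
          (W.twistedSharpFlatLocalFamily 2 κ J (-1) OddBlindTwist.two_dvd_neg_one_sub_one v
              (localTowerPointsOfEmb κ (closureEmb (K := ℚ) (v.adicCompletion ℚ)) W)
              (colemanKer κ (closureEmb (K := ℚ) (v.adicCompletion ℚ)) W (W.frobeniusTrace 2) g c .flat) v').map
            (galoisCohomology.map (ψ.restrictField (v'.adicCompletion ℚ)) 1) =
          ((resH1Hom (Literature.NumberTheory.EllipticCurves.subgroupIncl (localSubgroup κ.kerSubgroup (v'.adicCompletion ℚ)))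
              (AddMonoidHom.id (localPoints W₂ (v'.adicCompletion ℚ))) (fun _ _ ↦ rfl)).ker).comap
            (galoisCohomology.map (W₂.torsionPointsMapIntertwining ((2 ^ J : ℕ) : ℤ) (v'.adicCompletion ℚ)) 1)) ∧
        (W₂.kummerLocalConditionAt ((2 ^ J : ℕ) : ℤ) (v.adicCompletion ℚ)).map
            (galoisCohomology.map (φ.restrictField (v.adicCompletion ℚ)) 1) ≤
          W.twistedTorsionLocalKummer 2 κ J (-1) OddBlindTwist.two_dvd_neg_one_sub_one (v.adicCompletion ℚ)
            (localLayerPointsOfEmb κ (closureEmb (K := ℚ) (v.adicCompletion ℚ)) W 1 ⊓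
              (DistribSMul.toAddMonoidHom (localPoints W (v.adicCompletion ℚ)) g + AddMonoidHom.id _).ker) := by
  intro W _ _ _ κ hκ v _ g _ hg W₂ _ _ htw J
  obtain ⟨C, hC⟩ := htw
  obtain ⟨C₁, hC₁⟩ := W.exists_variableChange_quadraticTwist_one
  obtain ⟨θ, hθ, hfix, hneg⟩ := exists_sqrt_two_smul hκ
  -- the global twist map and the induced map on `2^J`-torsion
  set gm : W₂.geomPoints ≃+ W.geomPoints :=
    (twistPointsIso hC).symm.trans (W.twistGeomPointsEquiv hC₁ two_ne_zero hθ) with hgm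
  set n : ℤ := ((2 ^ J : ℕ) : ℤ) with hn
  set e : W₂.geomTorsion n ≃+ W.geomTorsion n := torsionByCongr gm n with he
  -- the sign rule for `gm` against the twist exponent
  have hsign : ∀ (σ : absoluteGaloisGroup ℚ) (T : W₂.geomTorsion n),
      e (σ • T) = ((-1 : ℤ) ^ κ.twistExponent J σ) • (σ • e T) := by
    intro σ T
    apply Subtype.ext
    rw [Literature.NumberTheory.EllipticCurves.coe_torsionByCongr_apply,
      Literature.NumberTheory.EllipticCurves.AddSubgroup.torsionBy.coe_smul, AddSubgroupClass.coe_zsmul,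
      Literature.NumberTheory.EllipticCurves.AddSubgroup.torsionBy.coe_smul,
      Literature.NumberTheory.EllipticCurves.coe_torsionByCongr_apply]
    rcases Nat.eq_zero_or_pos J with hJ0 | hJ
    · -- level `0`: the module is zero
      have hT : (T : W₂.geomPoints) = 0 := by
        have h2 : n • (T : W₂.geomPoints) = 0 := (Submodule.mem_torsionBy_iff _ _).mp T.2
        have hn1 : n = 1 := by rw [hn, hJ0, pow_zero, Nat.cast_one]
        have key : ∀ (m : ℤ) (P : W₂.geomPoints), m = 1 → m • P = 0 → P = 0 := by
          rintro m P rfl h; rwa [one_smul] at h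
        exact key n _ hn1 h2
      rw [hT, smul_zero, map_zero, smul_zero, smul_zero]
    · rw [neg_one_pow_twistExponent_smul κ hJ σ]
      by_cases hσ : σ ∈ κ.layerSubgroup 1
      · rw [if_pos hσ, twistMap_smul_of_eq W W₂ hC hC₁ hθ σ (hfix σ hσ)]
      · rw [if_neg hσ, twistMap_smul_of_eq_neg W W₂ hC hC₁ hθ σ (hneg σ hσ)]
  -- the intertwining maps
  let φ : (W₂.torsionGaloisModule n).toContRepresentation →ⁱL
      (W.twistedTorsionGaloisModule 2 κ J (-1) two_dvd_neg_one_sub_one).toContRepresentation :=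
    { toContinuousLinearMap := ⟨e.toAddMonoidHom.toIntLinearMap, continuous_of_discreteTopology⟩
      isIntertwining' := fun σ ↦ by
        refine ContinuousLinearMap.ext fun T ↦ ?_
        change e (W₂.torsionGaloisModule n σ T) = W.twistedTorsionGaloisModule 2 κ J (-1) two_dvd_neg_one_sub_one σ (e T)
        rw [ZpExtension.galoisTwist_apply_apply, torsionGaloisModule_apply_apply, torsionGaloisModule_apply_apply]
        exact hsign σ T }
  let ψ : (W.twistedTorsionGaloisModule 2 κ J (-1) two_dvd_neg_one_sub_one).toContRepresentation →ⁱL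
      (W₂.torsionGaloisModule n).toContRepresentation :=
    { toContinuousLinearMap := ⟨e.symm.toAddMonoidHom.toIntLinearMap, continuous_of_discreteTopology⟩
      isIntertwining' := fun σ ↦ by
        refine ContinuousLinearMap.ext fun S ↦ ?_
        change e.symm (W.twistedTorsionGaloisModule 2 κ J (-1) two_dvd_neg_one_sub_one σ S) = W₂.torsionGaloisModule n σ (e.symm S)
        apply e.injective
        rw [AddEquiv.apply_symm_apply, ZpExtension.galoisTwist_apply_apply, torsionGaloisModule_apply_apply,
          torsionGaloisModule_apply_apply, hsign, AddEquiv.apply_symm_apply] }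
  have hψφ : ∀ a, ψ (φ a) = a := fun a ↦ e.symm_apply_apply a
  have hφψ : ∀ b, φ (ψ b) = b := fun b ↦ e.apply_symm_apply b
  have hφ : ∀ T : W₂.geomTorsion n, ((φ T : W.geomTorsion n) : W.geomPoints) = gm (T : W₂.geomPoints) :=
    fun T ↦ rfl
  -- the local companion `g_E` at an arbitrary `ℚ`-field `E`: the local square, equivariance on the local tower
  -- subgroup (which fixes `θ_E`), and the sign rules
  have hdata : ∀ (E : Type) [Field E] [Algebra ℚ E], ∃ gE : localPoints W₂ E ≃+ localPoints W E,
      (∀ P : W₂.geomPoints, pointsMap W E (gm P) = gE (pointsMap W₂ E P)) ∧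
      (∀ τ : absoluteGaloisGroup E, τ ∈ localSubgroup κ.kerSubgroup E →
        ∀ Q : localPoints W₂ E, gE (τ • Q) = τ • gE Q) ∧
      (∀ τ : absoluteGaloisGroup E, resGal (K := ℚ) E τ ∈ κ.layerSubgroup 1 →
        ∀ Q : localPoints W₂ E, gE (τ • Q) = τ • gE Q) ∧
      (∀ τ : absoluteGaloisGroup E, resGal (K := ℚ) E τ ∉ κ.layerSubgroup 1 →
        ∀ Q : localPoints W₂ E, gE (τ • Q) = -(τ • gE Q)) := by
    intro E _ _
    refine ⟨(twistLocalIso E hC).symm.trans (W.twistLocalPointsEquiv hC₁ two_ne_zero E (closureEmb_sq_eq hθ E)),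
      fun P ↦ pointsMap_twistMap W W₂ hC hC₁ hθ E P, ?_, ?_, ?_⟩
    · intro τ hτ Q
      exact twistLocalMap_smul_of_eq W W₂ hC hC₁ hθ E τ
        (by rw [smul_closureEmb, hfix _ (κ.kerSubgroup_le_layerSubgroup 1 ((mem_localSubgroup_iff _ E τ).mp hτ))]) Q
    · intro τ hτ Q
      exact twistLocalMap_smul_of_eq W W₂ hC hC₁ hθ E τ (by rw [smul_closureEmb, hfix _ hτ]) Q
    · intro τ hτ Q
      exact twistLocalMap_smul_of_eq_neg W W₂ hC hC₁ hθ E τ (by rw [smul_closureEmb, hneg _ hτ, map_neg]) Q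
  refine ⟨φ, ψ, hψφ, hφψ, ?_, ?_, ?_⟩
  · -- (ii) the infinite places: the local tower subgroup is all of `Γ_{ℚ_w}`
    intro w
    obtain ⟨gE, hsq, hgEeq, -, -⟩ := hdata w.Completion
    exact (map_ker_twistedTorsionToLocalH1_eq_comap W W₂ 2 κ J (-1) two_dvd_neg_one_sub_one w.Completion gm gE
      hsq hgEeq φ hφ ψ hψφ hφψ).trans
      (comap_ker_resH1Hom_eq_kummerLocalConditionAt_of_forall_mem W₂ w.Completion n _
        fun τ ↦ (mem_localSubgroup_iff _ _ τ).mpr (ZpExtension.resGal_infinitePlace_mem_kerSubgroup κ w τ))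
  · -- (iii) the finite places `v' ≠ v`: the ♭-family member is the tower kernel
    intro v' hv'
    obtain ⟨gE, hsq, hgEeq, -, -⟩ := hdata (v'.adicCompletion ℚ)
    rw [W.twistedSharpFlatLocalFamily_of_ne 2 κ J (-1) two_dvd_neg_one_sub_one v _ _ hv']
    exact map_ker_twistedTorsionToLocalH1_eq_comap W W₂ 2 κ J (-1) two_dvd_neg_one_sub_one (v'.adicCompletion ℚ)
      gm gE hsq hgEeq φ hφ ψ hψφ hφψ
  · -- (iv) at `v`: the local Kummer condition lands in the Kummer line of the `ψ₂`-vectors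
    set E := v.adicCompletion ℚ with hE
    obtain ⟨gE, hsq, hgEeq, hgEfix, hgEneg⟩ := hdata E
    refine map_kummerLocalConditionAt_le_twistedTorsionLocalKummer W W₂ 2 κ J (-1) two_dvd_neg_one_sub_one E gm gE
      hsq hgEeq φ hφ _ fun Q hQ ↦ ⟨J, ?_⟩
    -- the point `x = 2^J Q ∈ W₂(ℚ_v)` and its image `gE x`
    have hx : 2 ^ J • gE Q = gE ((((2 ^ J : ℕ) : ℤ)) • Q) := by
      rw [← map_nsmul, ← natCast_zsmul, Nat.cast_pow, Nat.cast_ofNat]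
    have hQfix : ∀ τ : absoluteGaloisGroup E, τ • ((((2 ^ J : ℕ) : ℤ)) • Q) = (((2 ^ J : ℕ) : ℤ)) • Q :=
      fun τ ↦ hQ τ
    rw [hx]
    refine AddSubgroup.mem_inf.mpr ⟨?_, ?_⟩
    · -- fixed by `Gal(ℚ̄_v/ℚ_{1,v})`
      rw [mem_localLayerPointsOfEmb_iff]
      intro τ hτ
      have hτ' : resGal (K := ℚ) E τ ∈ κ.layerSubgroup 1 := by
        rw [ZpExtension.mem_layerSubgroup]
        exact (mem_localLayerSubgroupOfEmb_iff κ _ 1 τ).mp hτ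
      rw [← hgEfix τ hτ' _, hQfix τ]
    · -- negated by the local topological generator `g`
      have hg' : resGal (K := ℚ) E g ∉ κ.layerSubgroup 1 := by
        rw [ZpExtension.mem_layerSubgroup, pow_one]
        have h1 : κ (resGal (K := ℚ) E g) = Multiplicative.ofAdd 1 := hg
        rw [h1, toAdd_ofAdd]
        intro hdvd
        exact (PadicInt.irreducible_p (p := 2)).not_isUnit (isUnit_of_dvd_one hdvd)
      rw [AddMonoidHom.mem_ker, AddMonoidHom.add_apply, AddMonoidHom.id_apply, DistribSMul.toAddMonoidHom_apply]
      have h := hgEneg g hg' ((((2 ^ J : ℕ) : ℤ)) • Q)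
      rw [hQfix g] at h
      -- `gE x = -(g • gE x)`
      have h' : g • gE ((((2 ^ J : ℕ) : ℤ)) • Q) + gE ((((2 ^ J : ℕ) : ℤ)) • Q) =
          g • gE ((((2 ^ J : ℕ) : ℤ)) • Q) + -(g • gE ((((2 ^ J : ℕ) : ℤ)) • Q)) :=
        congrArg (fun y ↦ g • gE ((((2 ^ J : ℕ) : ℤ)) • Q) + y) h
      rw [h', add_neg_cancel]

end Hand

end Summit.BirchSwinnertonDyer.BirchSwinnertonDyer.Theorems.FlatBlindTwistSide

end
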